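import Summits.BirchSwinnertonDyer.BirchSwinnertonDyer.Theorems.GenusKolyvaginAtTwoGenusPrimitiveSupplyAtTwoPosDiscShallowOfWallU2
import HarnessLib

/-!
# Crux 25504 `GenusPrimitiveSupplyAtTwoPosDiscShallow` (Δ>0) — skeleton «wall_road» (LEAD bsd-line-gk2-p1 g29): the crux BY NAME from FIVE stubs, every one an
# EXISTING route item (or a conjunction of such); NO K-item, NO beyond-print stub

Registered composition: `GenusPrimitiveSupplyAtTwoPosDiscShallow_of` = gk2-p2 g28's `GenusSupplyPos.OfWallU2.genusPrimitiveSupplyAtTwoPosDiscShallow_of_items_of_wall_U2_Q2`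
(p791985 ✓) fed by the stubs.  **No summit is proved by a line; the crux is NOT closed (the stubs are OPEN route items); BSD is NOT proved.**

Stubs (5):
* `stub_wallRankZeroAtTwo` — WALL row 1: BSD₂ for non-CM curves of analytic rank 0 = the four `ByReductionTypeAtTwo` rows 19095–19098 together
  (each row is this statement restricted to one reduction type at 2).
* `stub_minimalTwinBSDTwo` — U₂ (22985) by name.
* `stub_kolyvaginRelationAtTwo` — Q2 (24880) by name.
* `stub_rankOneTwoConverse` — the rank-one 2-converse for non-CM globally minimal curves = items 19220 (good-ordinary ∪ multiplicative at 2) and 24948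
  (the rest) together.
* `stub_printFacts` — GZ-all-levels (24148) ∧ Modularity (19382) ∧ 2-parity (23327) ∧ GZK (19921) ∧ entire L (19273) ∧ Milne (24149), by name.
Why the K-items disappeared: the pen's LINE 33 v1.5 road K4Pos ⟸ WALL+U₂+Q2+PRINT (real place = witness for (NPh_K) on Δ>0, gk2-p4) ported by gk2-p2 g28;
K₁⁺ is the pair ledger against `#Ш(E/K)[2^∞] = 1`).  LEAD-BRIEF-g29 §1–§2.
-/

set_option autoImplicit false
set_option linter.dupNamespace false

noncomputable section

open scoped Classical

namespace Summit.BirchSwinnertonDyer.BirchSwinnertonDyer.Cruxes.GenusPrimitiveSupplyAtTwoPosDiscShallow.WallRoad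

open WeierstrassCurve Literature.NumberTheory.EllipticCurves
open Summit.BirchSwinnertonDyer.BirchSwinnertonDyer.Theses.GenusKolyvaginAtTwo
open Summit.BirchSwinnertonDyer.BirchSwinnertonDyer.Theses.ByReductionTypeAtTwo
  (GoodOrdinaryRankZeroAtTwo MultiplicativeRankZeroAtTwo SupersingularRankZeroAtTwo AdditiveRankZeroAtTwo)

/-- **WALL row 1 (stub = items 19095–19098 together): BSD₂ for non-CM curves of analytic rank `0`.** -/
theorem stub_wallRankZeroAtTwo :
    ∀ (W : WeierstrassCurve ℚ) [W.IsElliptic] [W.IsGloballyMinimal], ¬ W.HasCM → W.analyticRank = 0 → BSDp W 2 := by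
  sorry

/-- **U₂ (stub = item 22985 by name).** -/
theorem stub_minimalTwinBSDTwo : MinimalTwinBSDTwo := by
  sorry

/-- **Q2 (stub = item 24880 by name).** -/
theorem stub_kolyvaginRelationAtTwo : KolyvaginRelationAtTwo := by
  sorry

/-- **The rank-one 2-converse for non-CM globally minimal curves (stub = items 19220 and 24948 together).** -/
theorem stub_rankOneTwoConverse :
    ∀ (V : WeierstrassCurve ℚ) [V.IsElliptic] [V.IsGloballyMinimal], ¬ V.HasCM → V.selmerCorank 2 = 1 → V.analyticRank = 1 := by
  sorry

/-- **PRINT (stub = items 24148 ∧ 19382 ∧ 23327 ∧ 19921 ∧ 19273 ∧ 24149 by name).** -/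
theorem stub_printFacts : GrossZagierAllLevels ∧ ModularityExistsNewform ∧ TwoParityDD ∧ MultPublishedInputsAtTwo ∧ EntireLFunctionRat ∧
    MilneAnyModel := by
  sorry

/-- **COMPOSITION (kernel-checked, no `sorry` of its own): the crux 25504 BY NAME from the five stubs** — gk2-p2 g28's
`GenusSupplyPos.OfWallU2.genusPrimitiveSupplyAtTwoPosDiscShallow_of_items_of_wall_U2_Q2` (p791985).  Nothing is closed; BSD is NOT proved. -/
theorem GenusPrimitiveSupplyAtTwoPosDiscShallow_of : GenusPrimitiveSupplyAtTwoPosDiscShallow := by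
  obtain ⟨hGZ, hmod, hpar, hGZK, hL, hMi⟩ := stub_printFacts
  exact Summit.BirchSwinnertonDyer.BirchSwinnertonDyer.Theorems.GenusSupplyPos.OfWallU2.genusPrimitiveSupplyAtTwoPosDiscShallow_of_items_of_wall_U2_Q2 hGZ
    hmod hpar (fun V _ _ hV _ hco ↦ stub_rankOneTwoConverse V hV hco) (fun V _ _ hV _ hco ↦ stub_rankOneTwoConverse V hV hco)
    (fun W _ _ hcm hr0 _ ↦ stub_wallRankZeroAtTwo W hcm hr0) (fun W _ _ hcm hr0 _ ↦ stub_wallRankZeroAtTwo W hcm hr0)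
    (fun W _ _ hcm hr0 _ ↦ stub_wallRankZeroAtTwo W hcm hr0) (fun W _ _ hcm hr0 _ ↦ stub_wallRankZeroAtTwo W hcm hr0)
    stub_minimalTwinBSDTwo stub_kolyvaginRelationAtTwo hGZK hL hMi

end Summit.BirchSwinnertonDyer.BirchSwinnertonDyer.Cruxes.GenusPrimitiveSupplyAtTwoPosDiscShallow.WallRoad

end
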